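import Mathlib

/-!
# Second-eigenvalue (Rayleigh) bound from a quadratic matrix identity, without the spectral theorem
# (crux `LevelGradedCohnUmans.GradedDesignFamily`, stmt-MatrixMultiplication-7610; negative side,
# line `quadratic-extension-level-one-cell`, stub `rayleigh_le_of_mul_self_eq`)

Let `A` be a real symmetric `V × V` matrix satisfying a strongly-regular-type identity
`A * A = α • A + β • 1 + γ • J` (`J` the all-ones matrix), let `r` be a root of
`r ^ 2 = α * r + β` with `α ≤ 2 * r` (i.e. `r` is the LARGER root), and let `x : V → ℝ` have
coordinate sum `0`.  Then

* `rayleigh_le_of_mul_self_eq` — `x ⬝ᵥ A *ᵥ x ≤ r * (x ⬝ᵥ x)`.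

This is the Rayleigh-quotient hypothesis fed to the expander mixing lemma in the L1-row theorem of
the line's negative programme (for the Grassmann graph of lines of `PG(3,q)`:
`A² = (q²-q-2)A + (q+1)²(q-1)I + (q+1)²J`, `r = q²-1`).

Proof (no spectral theorem).  Put `n := x ⬝ᵥ x ≥ 0` and `t := x ⬝ᵥ A *ᵥ x`.
1. `J *ᵥ x = 0` because `∑ x = 0`, so `(A * A) *ᵥ x = α • A *ᵥ x + β • x` and hence
   `x ⬝ᵥ (A * A) *ᵥ x = α * t + β * n`.
2. By symmetry `x ⬝ᵥ (A * A) *ᵥ x = (A *ᵥ x) ⬝ᵥ (A *ᵥ x)`.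
3. Cauchy–Schwarz (`Finset.sum_mul_sq_le_sq_mul_sq`): `t ^ 2 ≤ n * ((A *ᵥ x) ⬝ᵥ (A *ᵥ x))
   = n * (α * t + β * n)`.
4. Pure real arithmetic (`rayleigh_le_of_mul_self_eq_real_aux`): if `t > r * n` then
   `t - r * n > 0` and `t + r * n - α * n > (2 r - α) n ≥ 0`, while
   `(t - r n)(t + r n - α n) = t² - α n t + (α r - r²) n² = t² - α n t - β n² ≤ 0` by 3 and
   `r² = α r + β` — contradiction.

Sorry-free; axioms `propext`, `Classical.choice`, `Quot.sound`.
-/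

set_option linter.dupNamespace false

open scoped BigOperators

namespace Summit.MatrixMultiplication.MatrixMultiplication.Theorems.GradedDesignFamily.Negative

/-- Real-arithmetic core of `rayleigh_le_of_mul_self_eq`: if `r² = α r + β`, `α ≤ 2 r`, `0 ≤ n`
and `t² ≤ n (α t + β n)` (the Cauchy–Schwarz consequence of the matrix identity), then
`t ≤ r n`.  Division-free: if `t > r n` then both factors of
`(t - r n) (t + r n - α n) = t² - α n t - β n²` are positive, yet the product is `≤ 0`. -/
private theorem rayleigh_le_of_mul_self_eq_real_aux {α β r t n : ℝ} (hr : r ^ 2 = α * r + β)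
    (hαr : α ≤ 2 * r) (hn : 0 ≤ n) (hkey : t ^ 2 ≤ n * (α * t + β * n)) : t ≤ r * n := by
  by_contra h
  have h1 : 0 < t - r * n := sub_pos.mpr (not_le.mp h)
  have h2 : 0 < t + r * n - α * n := by
    nlinarith [mul_nonneg (sub_nonneg.mpr hαr) hn, not_le.mp h]
  have h3 : 0 < (t - r * n) * (t + r * n - α * n) := mul_pos h1 h2
  have h4 : r ^ 2 * (n * n) = (α * r + β) * (n * n) := by rw [hr]
  nlinarith [hkey, h3, h4]

/-- **Second-eigenvalue bound from a quadratic matrix identity (SRG-type), without the spectral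
theorem.**  If a real symmetric matrix `A` satisfies `A * A = α • A + β • 1 + γ • J` (`J` the
all-ones matrix), `r ^ 2 = α * r + β` and `α ≤ 2 * r` (so `r` is the larger root), then for every
vector `x` with `∑ v, x v = 0` one has `x ⬝ᵥ A *ᵥ x ≤ r * (x ⬝ᵥ x)`. [folklore; cf. the standard
eigenvalue computation for strongly regular graphs] -/
theorem rayleigh_le_of_mul_self_eq : ∀ {V : Type} [Fintype V] [DecidableEq V] (A : Matrix V V ℝ), A.IsSymm → ∀ (α β γ r : ℝ), A * A = α • A + β • (1 : Matrix V V ℝ) + γ • Matrix.of (fun _ _ : V => (1 : ℝ)) → r ^ 2 = α * r + β → α ≤ 2 * r → ∀ x : V → ℝ, ∑ v, x v = 0 → dotProduct x (A.mulVec x) ≤ r * dotProduct x x := by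
  intro V _ _ A hA α β γ r hAA hr hαr x hx
  -- Step 1: `J *ᵥ x = 0`.
  have hJ : (Matrix.of fun _ _ : V => (1 : ℝ)).mulVec x = 0 := by
    funext i
    simp [Matrix.mulVec, dotProduct, hx]
  -- Step 1': `(A * A) *ᵥ x = α • A *ᵥ x + β • x`.
  have hAAx : (A * A).mulVec x = α • A.mulVec x + β • x := by
    rw [hAA, Matrix.add_mulVec, Matrix.add_mulVec, Matrix.smul_mulVec, Matrix.smul_mulVec,
      Matrix.smul_mulVec, Matrix.one_mulVec, hJ, smul_zero, add_zero]
  -- Step 2: symmetry, `x ⬝ᵥ (A * A) *ᵥ x = (A *ᵥ x) ⬝ᵥ (A *ᵥ x)`.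
  have hsymm : dotProduct x ((A * A).mulVec x) = dotProduct (A.mulVec x) (A.mulVec x) := by
    rw [← Matrix.mulVec_mulVec, Matrix.dotProduct_mulVec, ← Matrix.mulVec_transpose, hA.eq]
  -- Step 3: Cauchy–Schwarz on the coordinates.
  have hCS : (dotProduct x (A.mulVec x)) ^ 2
      ≤ dotProduct x x * dotProduct (A.mulVec x) (A.mulVec x) := by
    have h := Finset.sum_mul_sq_le_sq_mul_sq Finset.univ x (A.mulVec x)
    simpa only [dotProduct, pow_two] using h
  have hAx : dotProduct (A.mulVec x) (A.mulVec x)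
      = α * dotProduct x (A.mulVec x) + β * dotProduct x x := by
    rw [← hsymm, hAAx, dotProduct_add, dotProduct_smul, dotProduct_smul, smul_eq_mul, smul_eq_mul]
  have hkey : (dotProduct x (A.mulVec x)) ^ 2
      ≤ dotProduct x x * (α * dotProduct x (A.mulVec x) + β * dotProduct x x) := hAx ▸ hCS
  have hn : 0 ≤ dotProduct x x := Finset.sum_nonneg fun i _ => mul_self_nonneg (x i)
  -- Step 4: real arithmetic.
  exact rayleigh_le_of_mul_self_eq_real_aux hr hαr hn hkey

end Summit.MatrixMultiplication.MatrixMultiplication.Theorems.GradedDesignFamily.Negative
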